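import Literature.Barriers.FinalStateConjecture.NonSmoothNullInfinityExistence
import Mathlib.Analysis.Calculus.ContDiff.Deriv
import Mathlib.Analysis.SpecificLimits.Basic
import HarnessLib

/-!
# Barrier catalogue `FinalStateConjecture`: the limit of the radiation field on `𝓘⁺` for the
# linear scattering problem on Schwarzschild (discharge of `SchwarzschildLinearScattering_futureLimit`)
(`Literature/Barriers/FinalStateConjecture/`; namespace `Literature.Barriers.FinalStateConjecture`)

For the scattering solution `ψ = rφ` of `NonSmoothNullInfinityExistence.lean` (data `G` smooth,
supported in `(v₁, v₂)`), this file proves that near `i⁰`/`𝓘⁻` — for `u ≤ U₀`, `U₀` so negative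
that `r(U₀, v₁) ≥ 4M` — the radiation field is bounded uniformly in `v` (`|ψ| ≤ 2 sup|G|`, a second
contraction argument, in the plain sup norm over `{u ≤ U₀}`), that all its `u`-derivatives are
bounded there (`UFam`, the sub-family of the bootstrap family generated by the `v`-primitives of
`V ·` (bounded)), that the limit `ψ(u, ∞) = lim_{v → ∞} ψ(u, v) = −∫_{v₁}^{∞} ∫_{−∞}^{u} Vψ` exists
(`scatFutureLimit`), and that `u ↦ ψ(u, ∞)` is smooth on `(−∞, U₀)` (differentiation under the
integral sign, by induction over the family `V · UFam`, majorant `2M/r(U₀, v)³`). This is the input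
"`rφ` attains a limit on `𝓘⁺`", "`rφ^T(u,v) = rφ^T(u,∞) − ∫_v^∞ ∂ᵥ(rφ^T)`",
"`F(u) = ∫ lim_{v→∞}(2mν rφ)` [...] smooth functions `f_i`" of Kehrberger's proofs of Thms. 4.3, 6.1
and 6.2 (arXiv:2105.08079), and gives `SchwarzschildLinearScattering_futureLimit_holds`.

## References

* L. M. A. Kehrberger, Ann. Henri Poincaré 23 (2022) 829–921 = arXiv:2105.08079, proofs of Thm. 4.3
  and Thm. 6.2. Key `Kehrberger2022AHP`.
-/

noncomputable section

open Set Filter Topology MeasureTheory intervalIntegral Function Polynomial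

namespace Literature.Barriers.FinalStateConjecture

/-! ### The potential along outgoing null lines -/

section VLine

variable {M : ℝ} {r : ℝ → ℝ → ℝ} (hr : IsEFAreaRadius M r) (hM : 0 < M)
include hr hM

/-- Along an outgoing null line `u = const`, `v ↦ −M/r(u,v)²` is an antiderivative of the potential:
`∂ᵥ(−M/r²) = 2M ∂ᵥr/r³ = V(r)`. [folklore] -/
theorem IsEFAreaRadius.hasDerivAt_neg_div_sq_right (u v : ℝ) :
    HasDerivAt (fun v' ↦ -(M / r u v' ^ 2)) (radialPotential M (r u v)) v := by
  have hr0 : r u v ≠ 0 := (hr.pos hM.le u v).ne'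
  have h : HasDerivAt (fun v' ↦ M / r u v' ^ 2)
      ((0 * r u v ^ 2 - M * ((2 : ℕ) * r u v ^ (2 - 1) * (1 - 2 * M / r u v))) / (r u v ^ 2) ^ 2) v :=
    (hasDerivAt_const v M).div ((hr.2.1 u v).pow 2) (pow_ne_zero 2 hr0)
  refine h.neg.congr_deriv ?_
  norm_num [radialPotential]
  field_simp

/-- **The exact outgoing null-line integral of the potential**:
`∫_{v₁}^{v} V(r(u,v')) dv' = M/r(u,v₁)² − M/r(u,v)²`. [folklore] -/
theorem IsEFAreaRadius.integral_potential_right (u v₁ v : ℝ) :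
    ∫ v' in v₁..v, radialPotential M (r u v') = M / r u v₁ ^ 2 - M / r u v ^ 2 := by
  have hc : Continuous fun v' ↦ radialPotential M (r u v') :=
    (continuous_potential hr hM).comp (Continuous.prodMk_right u)
  rw [intervalIntegral.integral_eq_sub_of_hasDerivAt (fun x _ ↦ hr.hasDerivAt_neg_div_sq_right hM u x)
    (hc.intervalIntegrable _ _)]
  ring

/-- `∫_{v₁}^{v} V ≤ M/r(u,v₁)²` for `v ≥ v₁`. [folklore] -/
lemma IsEFAreaRadius.integral_potential_right_le (u v₁ v : ℝ) :
    ∫ v' in v₁..v, radialPotential M (r u v') ≤ M / r u v₁ ^ 2 := by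
  rw [hr.integral_potential_right hM]
  have : 0 ≤ M / r u v ^ 2 := by have := hr.pos hM.le u v; positivity
  linarith

/-- **The `v`-primitive of `V · f` is small towards `𝓘⁻`**: if `|f(u, ·)| ≤ B` on `[v₁, v]` then
`|∫_{v₁}^{v} V f| ≤ B M/r(u,v₁)²`. [folklore] -/
theorem abs_vPrimitive_potential_mul_le {f : ℝ → ℝ → ℝ} {u v₁ v B : ℝ}
    (hv : v₁ ≤ v) (hB : ∀ v' ∈ Icc v₁ v, |f u v'| ≤ B) :
    |vPrimitive v₁ (fun u v ↦ radialPotential M (r u v) * f u v) u v| ≤ B * (M / r u v₁ ^ 2) := by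
  have hB0 : 0 ≤ B := (abs_nonneg _).trans (hB v₁ ⟨le_rfl, hv⟩)
  rw [vPrimitive_apply]
  have hcV : Continuous fun v' ↦ radialPotential M (r u v') :=
    (continuous_potential hr hM).comp (Continuous.prodMk_right u)
  have h := intervalIntegral.norm_integral_le_of_norm_le (μ := volume) hv
    (f := fun v' ↦ radialPotential M (r u v') * f u v') (g := fun v' ↦ B * radialPotential M (r u v'))
    (Eventually.of_forall fun v' hv' ↦ ?_) ((hcV.const_mul B).intervalIntegrable _ _)
  · rw [Real.norm_eq_abs] at h
    refine h.trans ?_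
    rw [intervalIntegral.integral_const_mul]
    exact mul_le_mul_of_nonneg_left (hr.integral_potential_right_le hM u v₁ v) hB0
  · have hp : 0 ≤ radialPotential M (r u v') := (radialPotential_pos hM (hr.1 u v')).le
    rw [Real.norm_eq_abs, abs_mul, abs_of_nonneg hp, mul_comm]
    exact mul_le_mul_of_nonneg_right (hB v' ⟨hv'.1.le, hv'.2⟩) hp

end VLine

/-! ### Outgoing null lines: integrability of the potential and of `M/r²`, `2M/r³` towards `𝓘⁺` -/

section OutgoingIntegrals

variable {M : ℝ} {r : ℝ → ℝ → ℝ} (hr : IsEFAreaRadius M r) (hM : 0 < M)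
include hr hM

/-- `−M/r(u,v)² → 0` as `v → ∞`. [folklore] -/
lemma IsEFAreaRadius.tendsto_neg_div_sq_atTop (u : ℝ) :
    Tendsto (fun v ↦ -(M / r u v ^ 2)) atTop (𝓝 0) := by
  have h := ((tendsto_pow_atTop (n := 2) (by norm_num)).comp (hr.tendsto_atTop hM.le u)).inv_tendsto_atTop
  simpa [div_eq_mul_inv] using (h.const_mul M).neg

/-- The potential is integrable along every outgoing null line towards `𝓘⁺`. [folklore] -/
theorem IsEFAreaRadius.integrableOn_potential_Ioi (u a : ℝ) :
    IntegrableOn (fun v' ↦ radialPotential M (r u v')) (Ioi a) :=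
  integrableOn_Ioi_deriv_of_nonneg' (fun v' _ ↦ hr.hasDerivAt_neg_div_sq_right hM u v')
    (fun v' _ ↦ (radialPotential_pos hM (hr.1 u v')).le) (hr.tendsto_neg_div_sq_atTop hM u)

/-- `∫_a^∞ V(r(u,v')) dv' = M/r(u,a)²`. [folklore] -/
theorem IsEFAreaRadius.integral_potential_Ioi (u a : ℝ) :
    ∫ v' in Ioi a, radialPotential M (r u v') = M / r u a ^ 2 := by
  have h := integral_Ioi_of_hasDerivAt_of_tendsto' (fun v' _ ↦ hr.hasDerivAt_neg_div_sq_right hM u v')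
    (hr.integrableOn_potential_Ioi hM u a) (hr.tendsto_neg_div_sq_atTop hM u)
  rw [h]; ring

omit hr in
/-- `1 − 2M/ρ ≥ 1/2` once `ρ ≥ 4M` (`M > 0`). [folklore] -/
lemma factor_ge_half {ρ : ℝ} (hρ : 4 * M ≤ ρ) : 1 / 2 ≤ 1 - 2 * M / ρ := by
  have hρ0 : 0 < ρ := lt_of_lt_of_le (by positivity) hρ
  have h1 : 2 * M / ρ ≤ 1 / 2 := by
    rw [div_le_iff₀ hρ0]; linarith
  linarith

/-- Along an outgoing null line, `v ↦ −1/r(u,v)` has derivative `(1 − 2M/r)/r²`. [folklore] -/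
lemma IsEFAreaRadius.hasDerivAt_neg_inv_right (u v : ℝ) :
    HasDerivAt (fun v' ↦ -(r u v')⁻¹) ((1 - 2 * M / r u v) / r u v ^ 2) v := by
  have h := ((hr.2.1 u v).inv (hr.pos hM.le u v).ne').neg
  refine h.congr_deriv ?_
  ring

/-- Continuity of `v' ↦ M/r(u,v')²`. [folklore] -/
lemma continuous_div_sq_snd (u : ℝ) : Continuous fun v' ↦ M / r u v' ^ 2 :=
  continuous_const.div ((hr.continuous_snd u).pow 2) fun v' ↦ pow_ne_zero 2 (hr.pos hM.le u v').ne'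

/-- **`∫_{v₁}^{v} M/r² dv' ≤ 2M/r(u,v₁)` when `r(u,v₁) ≥ 4M`** (compare with `2M ∂ᵥ(−1/r)`).
[folklore] -/
lemma integral_div_sq_le {u v₁ v : ℝ} (h4 : 4 * M ≤ r u v₁) (hv : v₁ ≤ v) :
    ∫ v' in v₁..v, M / r u v' ^ 2 ≤ 2 * M / r u v₁ := by
  have hderiv : ∀ x : ℝ, HasDerivAt (fun v' ↦ 2 * M * -(r u v')⁻¹)
      (2 * M * ((1 - 2 * M / r u x) / r u x ^ 2)) x :=
    fun x ↦ (hr.hasDerivAt_neg_inv_right hM u x).const_mul (2 * M)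
  have hc2 : Continuous fun v' ↦ 2 * M * ((1 - 2 * M / r u v') / r u v' ^ 2) := by
    refine continuous_const.mul ((continuous_const.sub ?_).div ((hr.continuous_snd u).pow 2)
      fun v' ↦ pow_ne_zero 2 (hr.pos hM.le u v').ne')
    exact continuous_const.div (hr.continuous_snd u) fun v' ↦ (hr.pos hM.le u v').ne'
  have hmono : ∀ v' ∈ Icc v₁ v, M / r u v' ^ 2 ≤ 2 * M * ((1 - 2 * M / r u v') / r u v' ^ 2) := by
    intro v' hv'
    have hr4 : 4 * M ≤ r u v' := h4.trans ((hr.strictMono_right hM u).monotone hv'.1)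
    have hD := factor_ge_half hM hr4
    have h0 : 0 < r u v' := hr.pos hM.le u v'
    have h2 : 0 < r u v' ^ 2 := by positivity
    rw [mul_div_assoc', div_le_div_iff_of_pos_right h2]
    nlinarith
  calc ∫ v' in v₁..v, M / r u v' ^ 2 ≤ ∫ v' in v₁..v, 2 * M * ((1 - 2 * M / r u v') / r u v' ^ 2) :=
        intervalIntegral.integral_mono_on hv ((continuous_div_sq_snd hr hM u).intervalIntegrable _ _)
          (hc2.intervalIntegrable _ _) hmono
    _ = 2 * M * -(r u v)⁻¹ - 2 * M * -(r u v₁)⁻¹ :=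
        intervalIntegral.integral_eq_sub_of_hasDerivAt (fun x _ ↦ hderiv x) (hc2.intervalIntegrable _ _)
    _ ≤ 2 * M / r u v₁ := by
        have h0 : 0 < r u v := hr.pos hM.le u v
        have : 0 ≤ (r u v)⁻¹ := (inv_pos.2 h0).le
        rw [div_eq_mul_inv]
        nlinarith

/-- `M/r(u,·)²` is integrable towards `𝓘⁺` (compare with `∂ᵥ(−1/r) ≥ D₀/r²`). [folklore] -/
theorem IsEFAreaRadius.integrableOn_div_sq_Ioi (u a : ℝ) :
    IntegrableOn (fun v' ↦ M / r u v' ^ 2) (Ioi a) := by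
  set D₀ := 1 - 2 * M / r u a with hD₀
  have hD₀pos : 0 < D₀ := hr.factor_pos hM.le u a
  have hint : IntegrableOn (fun v' ↦ (1 - 2 * M / r u v') / r u v' ^ 2) (Ioi a) := by
    refine integrableOn_Ioi_deriv_of_nonneg' (fun v' _ ↦ hr.hasDerivAt_neg_inv_right hM u v')
      (fun v' _ ↦ div_nonneg (hr.factor_pos hM.le u v').le (sq_nonneg _)) (l := 0) ?_
    simpa using ((hr.tendsto_atTop hM.le u).inv_tendsto_atTop).neg
  refine Integrable.mono' (hint.const_mul (M / D₀)) (continuous_div_sq_snd hr hM u).aestronglyMeasurable ?_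
  refine (ae_restrict_iff' measurableSet_Ioi).2 (Eventually.of_forall fun v' hv' ↦ ?_)
  have h0 : 0 < r u v' := hr.pos hM.le u v'
  have hDle : D₀ ≤ 1 - 2 * M / r u v' := by
    have : 2 * M / r u v' ≤ 2 * M / r u a :=
      div_le_div_of_nonneg_left (by positivity) (hr.pos hM.le u a)
        ((hr.strictMono_right hM u).monotone (le_of_lt hv'))
    simp only [hD₀]; linarith
  rw [Real.norm_eq_abs, abs_of_pos (by positivity)]
  have h2 : 0 < r u v' ^ 2 := by positivity
  calc M / r u v' ^ 2 = M / D₀ * (D₀ / r u v' ^ 2) := by field_simp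
    _ ≤ M / D₀ * ((1 - 2 * M / r u v') / r u v' ^ 2) := by
        refine mul_le_mul_of_nonneg_left ?_ (by positivity)
        exact div_le_div_of_nonneg_right hDle h2.le

/-- `2M/r(u,·)³` is integrable towards `𝓘⁺` (it is `≤ V/D₀`). [folklore] -/
theorem IsEFAreaRadius.integrableOn_two_mul_div_cube_Ioi (u a : ℝ) :
    IntegrableOn (fun v' ↦ 2 * M / r u v' ^ 3) (Ioi a) := by
  set D₀ := 1 - 2 * M / r u a with hD₀
  have hD₀pos : 0 < D₀ := hr.factor_pos hM.le u a
  have hc : Continuous fun v' ↦ 2 * M / r u v' ^ 3 :=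
    continuous_const.div ((hr.continuous_snd u).pow 3) fun v' ↦ pow_ne_zero 3 (hr.pos hM.le u v').ne'
  refine Integrable.mono' ((hr.integrableOn_potential_Ioi hM u a).const_mul (1 / D₀)) hc.aestronglyMeasurable ?_
  refine (ae_restrict_iff' measurableSet_Ioi).2 (Eventually.of_forall fun v' hv' ↦ ?_)
  have h0 : 0 < r u v' := hr.pos hM.le u v'
  have hDle : D₀ ≤ 1 - 2 * M / r u v' := by
    have : 2 * M / r u v' ≤ 2 * M / r u a :=
      div_le_div_of_nonneg_left (by positivity) (hr.pos hM.le u a)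
        ((hr.strictMono_right hM u).monotone (le_of_lt hv'))
    simp only [hD₀]; linarith
  rw [Real.norm_eq_abs, abs_of_pos (by positivity), radialPotential]
  have h3 : 0 < r u v' ^ 3 := by positivity
  calc 2 * M / r u v' ^ 3 = 1 / D₀ * (2 * M * D₀ / r u v' ^ 3) := by field_simp
    _ ≤ 1 / D₀ * (2 * M * (1 - 2 * M / r u v') / r u v' ^ 3) := by
        refine mul_le_mul_of_nonneg_left ?_ (by positivity)
        exact div_le_div_of_nonneg_right (mul_le_mul_of_nonneg_left hDle (by positivity)) h3.le

/-- On `{u ≤ U₀}`, `2M/r(u,v)³ ≤ 2M/r(U₀,v)³` (`r` decreases in `u`). [folklore] -/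
lemma two_mul_div_cube_le_of_le {U₀ u : ℝ} (hu : u ≤ U₀) (v : ℝ) :
    2 * M / r u v ^ 3 ≤ 2 * M / r U₀ v ^ 3 := by
  have h1 : r U₀ v ≤ r u v := (hr.strictAnti_left hM v).antitone hu
  have h0 : 0 < r U₀ v := hr.pos hM.le U₀ v
  gcongr

end OutgoingIntegrals

/-! ### The uniform bound near `𝓘⁻` -/

section UniformBound

variable {M : ℝ} {r : ℝ → ℝ → ℝ} {h : ℝ → ℝ → ℝ} (hr : IsEFAreaRadius M r) (hM : 0 < M)
include hr hM

/-- Version of `abs_uPrimitive_le` with the pointwise bound only required on the ray `u' ≤ u`.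
[folklore] -/
theorem abs_uPrimitive_le_of_le {B u v : ℝ}
    (hB : ∀ u', u' ≤ u → |h u' v| ≤ B * radialPotential M (r u' v)) :
    |uPrimitive h u v| ≤ B * (M / r u v ^ 2) := by
  rw [uPrimitive_apply, ← Real.norm_eq_abs, ← hr.integral_potential_Iic hM u v,
    ← MeasureTheory.integral_const_mul]
  refine norm_integral_le_of_norm_le ((hr.integrableOn_potential_Iic hM u v).const_mul B) ?_
  exact (ae_restrict_iff' measurableSet_Iic).2 (Eventually.of_forall fun u' hu' ↦ hB u' hu')

/-- There is `U₀ < −1` with `r(u, v₁) ≥ 4M` for all `u ≤ U₀`. [folklore] -/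
lemma exists_radius_ge (v₁ : ℝ) : ∃ U₀ : ℝ, U₀ < -1 ∧ ∀ u, u ≤ U₀ → 4 * M ≤ r u v₁ := by
  have h := (hr.tendsto_atBot hM.le v₁).eventually (eventually_ge_atTop (4 * M))
  rw [eventually_atBot] at h
  obtain ⟨U, hU⟩ := h
  exact ⟨min U (-2), by norm_num, fun u hu ↦ hU u (hu.trans (min_le_left _ _))⟩

variable {v₁ : ℝ} {H : ℝ → ℝ} (hHc : Continuous H) {CH : ℝ} (hHb : ∀ v, |H v| ≤ CH)
  (hH0 : ∀ v, v ≤ v₁ → H v = 0)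

/-- **The scattering field is bounded near `𝓘⁻` uniformly in `v`**: if `r(u,v₁) ≥ 4M` for
`u ≤ U₀` then `|ψ| ≤ 2 C_H` on `{u ≤ U₀}` (all `v`): iterate the estimate
`|ψ| ≤ C_H + (sup |ψ|)·∫_{v₁}^{v} M/r² ≤ C_H + (sup|ψ|)/2` from the a-priori strip bounds. [folklore] -/
theorem abs_scatteringField_le_near_scri {U₀ : ℝ} (h4 : ∀ u, u ≤ U₀ → 4 * M ≤ r u v₁)
    {u : ℝ} (hu : u ≤ U₀) (v : ℝ) :
    |scatteringField hr hM hHc hHb hH0 u v| ≤ 2 * CH := by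
  set ψ := scatteringField hr hM hHc hHb hH0 with hψ
  set g : ℝ → ℝ → ℝ := fun u v ↦ radialPotential M (r u v) * ψ u v with hg
  have hCH : 0 ≤ CH := (abs_nonneg _).trans (hHb 0)
  have hgc : Continuous (uncurry g) := continuous_potential_mul_scatteringField hr hM _ _ _
  have hIc : Continuous (uncurry (uPrimitive g)) :=
    continuous_uPrimitive hr hM (isPotentialDominated_potential_mul_scatteringField hr hM _ _ _) hgc
  -- one improvement step on `{u ≤ U₀, v ≤ V}`
  have hstep : ∀ V B, 0 ≤ B → (∀ u, u ≤ U₀ → ∀ v, v ≤ V → |ψ u v| ≤ B) →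
      ∀ u, u ≤ U₀ → ∀ v, v ≤ V → |ψ u v| ≤ CH + B / 2 := by
    intro V B hB0 hB u hu v hv
    rcases le_or_gt v v₁ with hv1 | hv1
    · have hz : ψ u v = 0 := scatteringField_eq_zero hr hM hHc hHb hH0 hv1
      rw [hz, abs_zero]; positivity
    have heq : ψ u v = H v - vPrimitive v₁ (uPrimitive g) u v := scatteringField_eq hr hM hHc hHb hH0 u v
    rw [heq]
    refine (abs_sub _ _).trans (add_le_add (hHb v) ?_)
    have hΞ : ∀ v' ∈ Icc v₁ v, |uPrimitive g u v'| ≤ B * (M / r u v' ^ 2) := by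
      intro v' hv'
      refine abs_uPrimitive_le_of_le hr hM fun u' hu' ↦ ?_
      have hp : 0 ≤ radialPotential M (r u' v') := (radialPotential_pos hM (hr.1 u' v')).le
      show |radialPotential M (r u' v') * ψ u' v'| ≤ _
      rw [abs_mul, abs_of_nonneg hp, mul_comm]
      exact mul_le_mul_of_nonneg_right (hB u' (hu'.trans hu) v' (hv'.2.trans hv)) hp
    have h1 : |vPrimitive v₁ (uPrimitive g) u v| ≤ ∫ v' in v₁..v, B * (M / r u v' ^ 2) := by
      rw [vPrimitive_apply]
      have h := intervalIntegral.norm_integral_le_of_norm_le (μ := volume) hv1.le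
        (f := fun v' ↦ uPrimitive g u v') (g := fun v' ↦ B * (M / r u v' ^ 2))
        (Eventually.of_forall fun v' hv' ↦ by
          rw [Real.norm_eq_abs]; exact hΞ v' ⟨hv'.1.le, hv'.2⟩)
        (((continuous_div_sq_snd hr hM u).const_mul B).intervalIntegrable _ _)
      rwa [Real.norm_eq_abs] at h
    refine h1.trans ?_
    rw [intervalIntegral.integral_const_mul]
    have h2 := integral_div_sq_le hr hM (h4 u hu) hv1.le
    have h3 : 2 * M / r u v₁ ≤ 1 / 2 := by
      have h0 : 0 < r u v₁ := hr.pos hM.le u v₁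
      rw [div_le_div_iff₀ h0 (by norm_num)]; linarith [h4 u hu]
    calc B * ∫ v' in v₁..v, M / r u v' ^ 2 ≤ B * (1 / 2) :=
          mul_le_mul_of_nonneg_left (h2.trans h3) hB0
      _ = B / 2 := by ring
  -- iterate from the a-priori strip bound
  suffices key : ∀ V, ∀ u, u ≤ U₀ → ∀ v, v ≤ V → |ψ u v| ≤ 2 * CH from key v u hu v le_rfl
  intro V
  obtain ⟨B₀, hB₀⟩ := abs_scatteringField_le hr hM hHc hHb hH0 V
  have hB₀0 : 0 ≤ B₀ := (abs_nonneg _).trans (hB₀ 0 (min V 0) (min_le_left _ _))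
  set b : ℕ → ℝ := fun k ↦ 2 * CH + (B₀ - 2 * CH) / 2 ^ k with hb
  have hbk : ∀ k, ∀ u, u ≤ U₀ → ∀ v, v ≤ V → |ψ u v| ≤ b k := by
    intro k
    induction k with
    | zero => intro u hu v hv; simpa [hb] using hB₀ u v hv
    | succ k ih =>
      have hbk0 : 0 ≤ b k := (abs_nonneg _).trans (ih U₀ le_rfl (min V 0) (min_le_left _ _))
      intro u hu v hv
      have := hstep V (b k) hbk0 ih u hu v hv
      simp only [hb, pow_succ] at this ⊢
      have h2k : (0 : ℝ) < 2 ^ k := by positivity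
      field_simp at this ⊢
      nlinarith [this]
  have hlim : Tendsto b atTop (𝓝 (2 * CH)) := by
    have h : Tendsto (fun k : ℕ ↦ (B₀ - 2 * CH) * (1 / 2 : ℝ) ^ k) atTop (𝓝 ((B₀ - 2 * CH) * 0)) :=
      (tendsto_pow_atTop_nhds_zero_of_lt_one (by norm_num) (by norm_num)).const_mul _
    rw [mul_zero] at h
    have h' := h.const_add (2 * CH)
    rw [add_zero] at h'
    refine h'.congr fun k ↦ ?_
    simp only [hb, one_div, inv_pow]
    ring
  intro u hu v hv
  exact ge_of_tendsto' hlim fun k ↦ hbk k u hu v hv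

end UniformBound

/-! ### The `u`-derivative family and its bounds near `𝓘⁻` -/

section UFamily

/-- **The `u`-derivative family**: generated from `ψ` and the `H^{(j)}` by sums, polynomial-in-`1/r`
multipliers and the `v`-primitive of `V · P(1/r) · f`. It contains all `u`-derivatives of its
members (`UFam.exists_hasDerivAt_left`) and is bounded near `𝓘⁻` uniformly in `v`
(`UFam.bounded_near_scri`). [folklore] -/
inductive UFam (M : ℝ) (r : ℝ → ℝ → ℝ) (v₁ : ℝ) (H : ℝ → ℝ) (ψ : ℝ → ℝ → ℝ) :
    (ℝ → ℝ → ℝ) → Prop where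
  | sol : UFam M r v₁ H ψ ψ
  | data (j : ℕ) : UFam M r v₁ H ψ (fun _ v ↦ iteratedDeriv j H v)
  | add {f g : ℝ → ℝ → ℝ} : UFam M r v₁ H ψ f → UFam M r v₁ H ψ g →
      UFam M r v₁ H ψ (fun u v ↦ f u v + g u v)
  | smul (P : ℝ[X]) {f : ℝ → ℝ → ℝ} : UFam M r v₁ H ψ f →
      UFam M r v₁ H ψ (fun u v ↦ P.eval (r u v)⁻¹ * f u v)
  | vprimV (P : ℝ[X]) {f : ℝ → ℝ → ℝ} : UFam M r v₁ H ψ f →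
      UFam M r v₁ H ψ (vPrimitive v₁ fun u v ↦ radialPotential M (r u v) * (P.eval (r u v)⁻¹ * f u v))

namespace UFam

variable {M : ℝ} {r : ℝ → ℝ → ℝ} {v₁ : ℝ} {H : ℝ → ℝ} {ψ f : ℝ → ℝ → ℝ}
variable (hr : IsEFAreaRadius M r) (hM : 0 < M) (hb : ScatBootstrap M r v₁ H ψ)
include hr hM hb

omit hb in
/-- The `v`-primitive integrand `V P(ρ) f` is `(V·P)(ρ) f`. [folklore] -/
lemma vprimV_integrand_eq (P : ℝ[X]) (f : ℝ → ℝ → ℝ) :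
    (fun u v ↦ radialPotential M (r u v) * (P.eval (r u v)⁻¹ * f u v)) =
      fun u v ↦ (potentialPoly M * P).eval (r u v)⁻¹ * f u v := by
  funext u v; rw [eval_mul, radialPotential_eq_eval hr hM, mul_assoc]

omit hb in
/-- Members of the `u`-derivative family are members of the bootstrap family. [folklore] -/
theorem toScatFam (hf : UFam M r v₁ H ψ f) : ScatFam M r v₁ H ψ f := by
  induction hf with
  | sol => exact ScatFam.sol
  | data j => exact ScatFam.data j
  | add _ _ ihf ihg => exact ScatFam.add ihf ihg
  | smul P _ ih => exact ScatFam.smul P ih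
  | @vprimV P f _ ih =>
    rw [vprimV_integrand_eq hr hM P f]
    exact ScatFam.vprim (ScatFam.smul _ ih)

/-- Members are jointly continuous. [folklore] -/
theorem continuous (hf : UFam M r v₁ H ψ f) : Continuous (uncurry f) :=
  ScatFam.continuous hr hM hb (toScatFam hr hM hf)

/-- Members vanish on `{v ≤ v₁}`. [folklore] -/
theorem eq_zero (hf : UFam M r v₁ H ψ f) {u v : ℝ} (hv : v ≤ v₁) : f u v = 0 :=
  ScatFam.eq_zero hr hM hb (toScatFam hr hM hf) hv

/-- **The `u`-derivative family is bounded near `𝓘⁻` uniformly in `v`**, provided `ψ` is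
(data with compact support). [folklore] -/
theorem bounded_near_scri {U₀ Cψ : ℝ} {v₂ : ℝ} (hsupp : tsupport H ⊆ Ioo v₁ v₂)
    (hψ : ∀ u, u ≤ U₀ → ∀ v, |ψ u v| ≤ Cψ) (hf : UFam M r v₁ H ψ f) :
    ∃ C : ℝ, ∀ u, u ≤ U₀ → ∀ v, |f u v| ≤ C := by
  induction hf with
  | sol => exact ⟨Cψ, hψ⟩
  | data j =>
    obtain ⟨C, hC⟩ := exists_bound_of_tsupport
      (hb.contDiff_data.continuous_iteratedDeriv j (by exact_mod_cast le_top))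
      ((tsupport_iteratedDeriv_subset H j).trans hsupp)
    exact ⟨C, fun u _ v ↦ hC v⟩
  | add _ _ ihf ihg =>
    obtain ⟨C, hC⟩ := ihf; obtain ⟨C', hC'⟩ := ihg
    exact ⟨C + C', fun u hu v ↦ (abs_add_le _ _).trans (add_le_add (hC u hu v) (hC' u hu v))⟩
  | smul P _ ih =>
    obtain ⟨C, hC⟩ := ih
    obtain ⟨K, hK⟩ := exists_bound_eval_invRadius hr hM P
    refine ⟨K * C, fun u hu v ↦ ?_⟩
    rw [abs_mul]
    exact mul_le_mul (hK u v) (hC u hu v) (abs_nonneg _) ((abs_nonneg _).trans (hK u v))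
  | @vprimV P f hf ih =>
    obtain ⟨C, hC⟩ := ih
    obtain ⟨K, hK⟩ := exists_bound_eval_invRadius hr hM P
    refine ⟨K * C * (1 / (4 * M)), fun u hu v ↦ ?_⟩
    rcases le_or_gt v v₁ with hv | hv
    · rw [vPrimitive_eq_zero_of_le (fun u' v' hv' ↦ by
        simp [ScatFam.eq_zero hr hM hb (toScatFam hr hM hf) hv']) hv, abs_zero]
      have : 0 ≤ K * C := (abs_nonneg _).trans (by
        have := mul_le_mul (hK u v) (hC u hu v) (abs_nonneg _) ((abs_nonneg _).trans (hK u v))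
        rw [← abs_mul] at this; exact this)
      positivity
    · have h := abs_vPrimitive_potential_mul_le hr hM (f := fun u v ↦ P.eval (r u v)⁻¹ * f u v)
        (B := K * C) hv.le (u := u) fun v' _ ↦ by
          rw [abs_mul]
          exact mul_le_mul (hK u v') (hC u hu v') (abs_nonneg _) ((abs_nonneg _).trans (hK u v'))
      refine h.trans (mul_le_mul_of_nonneg_left (div_sq_lt hr hM u v₁).le ?_)
      exact (abs_nonneg _).trans (by
        have := mul_le_mul (hK u v) (hC u hu v) (abs_nonneg _) ((abs_nonneg _).trans (hK u v))
        rw [← abs_mul] at this; exact this)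

/-- **The `u`-derivative family contains the `u`-derivatives of its members.** [folklore] -/
theorem exists_hasDerivAt_left (hf : UFam M r v₁ H ψ f) :
    ∃ f₁ : ℝ → ℝ → ℝ, UFam M r v₁ H ψ f₁ ∧ ∀ u v, HasDerivAt (fun u' ↦ f u' v) (f₁ u v) u := by
  induction hf with
  | sol =>
    refine ⟨_, smul (C (-1)) (vprimV (C 1) sol), fun u v ↦ (hb.deriv_left u v).congr_deriv ?_⟩
    simp only [eval_C, one_mul, neg_mul]
  | data j =>
    refine ⟨_, smul (C 0) sol, fun u v ↦ ?_⟩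
    simpa using hasDerivAt_const u (iteratedDeriv j H v)
  | add _ _ ihf ihg =>
    obtain ⟨f₁, hf₁, hd⟩ := ihf; obtain ⟨g₁, hg₁, hd'⟩ := ihg
    exact ⟨_, add hf₁ hg₁, fun u v ↦ (hd u v).add (hd' u v)⟩
  | smul P hf ih =>
    obtain ⟨f₁, hf₁, hd⟩ := ih
    refine ⟨_, add (smul (derivative P * invRadiusDerivPoly M) hf) (smul P hf₁), fun u v ↦ ?_⟩
    exact ((hasDerivAt_eval_invRadius_left hr hM P u v).mul (hd u v)).congr_deriv (by ring)
  | @vprimV P f hf ih =>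
    obtain ⟨f₁, hf₁, hd⟩ := ih
    -- `∂ᵤ (V P(ρ) f) = V εᵤ(P)(ρ) f + V P(ρ) f₁`, `εᵤ = -εᵥ`
    set A : ℝ → ℝ → ℝ := fun u v ↦ radialPotential M (r u v) *
      ((C (-1) * potentialDerivPoly M P).eval (r u v)⁻¹ * f u v) with hA
    set B : ℝ → ℝ → ℝ := fun u v ↦ radialPotential M (r u v) * (P.eval (r u v)⁻¹ * f₁ u v) with hB
    have hAm : UFam M r v₁ H ψ (vPrimitive v₁ A) := vprimV _ hf
    have hBm : UFam M r v₁ H ψ (vPrimitive v₁ B) := vprimV _ hf₁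
    refine ⟨_, add hAm hBm, fun u v ↦ ?_⟩
    have hgc : Continuous (uncurry fun u v ↦ radialPotential M (r u v) * (P.eval (r u v)⁻¹ * f u v)) :=
      ScatFam.continuous_uprimIntegrand hr hM hb P (toScatFam hr hM hf)
    have hAc : Continuous (uncurry A) :=
      ScatFam.continuous_uprimIntegrand hr hM hb _ (toScatFam hr hM hf)
    have hBc : Continuous (uncurry B) :=
      ScatFam.continuous_uprimIntegrand hr hM hb _ (toScatFam hr hM hf₁)
    have hd1 : ∀ u v, HasDerivAt (fun u' ↦ radialPotential M (r u' v) * (P.eval (r u' v)⁻¹ * f u' v))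
        (A u v + B u v) u := by
      intro u v
      have h1 : HasDerivAt (fun u' ↦ (potentialPoly M * P).eval (r u' v)⁻¹ * f u' v)
          ((derivative (potentialPoly M * P) * invRadiusDerivPoly M).eval (r u v)⁻¹ * f u v +
            (potentialPoly M * P).eval (r u v)⁻¹ * f₁ u v) u :=
        (hasDerivAt_eval_invRadius_left hr hM _ u v).mul (hd u v)
      rw [show (fun u' ↦ radialPotential M (r u' v) * (P.eval (r u' v)⁻¹ * f u' v)) =
          fun u' ↦ (potentialPoly M * P).eval (r u' v)⁻¹ * f u' v from
        funext fun u' ↦ by rw [eval_mul, radialPotential_eq_eval hr hM, mul_assoc]]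
      refine h1.congr_deriv ?_
      have hid := congrArg (fun Q : ℝ[X] ↦ Q.eval (r u v)⁻¹) (potentialPoly_identity M P)
      simp only [eval_mul, eval_neg, neg_mul] at hid
      simp only [hA, hB, eval_mul, eval_C, radialPotential_eq_eval hr hM]
      linear_combination (-(f u v)) * hid
    have hABc : Continuous (uncurry fun u v ↦ A u v + B u v) := hAc.add hBc
    have h := hasDerivAt_vPrimitive_left (v₁ := v₁) hgc hABc hd1 u v
    rw [vPrimitive_add hAc hBc] at h
    exact h

/-- All `u`-derivatives `∂ᵤ^j ψ` are members of the family. [folklore] -/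
theorem iteratedDeriv_mem : ∀ j : ℕ, ∃ f : ℝ → ℝ → ℝ, UFam M r v₁ H ψ f ∧
    ∀ u v, iteratedDeriv j (fun u' ↦ ψ u' v) u = f u v
  | 0 => ⟨ψ, sol, fun u v ↦ by simp⟩
  | j + 1 => by
    obtain ⟨f, hf, hfeq⟩ := iteratedDeriv_mem j
    obtain ⟨f₁, hf₁, hd⟩ := exists_hasDerivAt_left hr hM hb hf
    refine ⟨f₁, hf₁, fun u v ↦ ?_⟩
    rw [iteratedDeriv_succ, show iteratedDeriv j (fun u' ↦ ψ u' v) = fun u' ↦ f u' v from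
      funext fun u' ↦ hfeq u' v]
    exact (hd u v).deriv

end UFam

end UFamily

/-! ### The limit on `𝓘⁺` and its smoothness in `u` -/

section FutureLimit

variable {M : ℝ} {r : ℝ → ℝ → ℝ} {v₁ v₂ : ℝ} {H : ℝ → ℝ} {ψ : ℝ → ℝ → ℝ}
variable (hr : IsEFAreaRadius M r) (hM : 0 < M) (hb : ScatBootstrap M r v₁ H ψ)
  (hsupp : tsupport H ⊆ Ioo v₁ v₂) {U₀ Cψ : ℝ} (hψ : ∀ u, u ≤ U₀ → ∀ v, |ψ u v| ≤ Cψ)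
include hr hM hb hsupp hψ

/-- The integrands `V · f`, `f ∈ UFam`, are dominated on `{u ≤ U₀}` by `C · 2M/r(U₀, v)³`,
integrable towards `𝓘⁺`. [folklore] -/
lemma exists_dominated {f : ℝ → ℝ → ℝ} (hf : UFam M r v₁ H ψ f) :
    ∃ C : ℝ, 0 ≤ C ∧ ∀ u, u ≤ U₀ → ∀ v, |radialPotential M (r u v) * f u v| ≤ C * (2 * M / r U₀ v ^ 3) := by
  obtain ⟨C, hC⟩ := hf.bounded_near_scri hr hM hb hsupp hψ
  have hC0 : 0 ≤ C := (abs_nonneg _).trans (hC U₀ le_rfl 0)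
  refine ⟨C, hC0, fun u hu v ↦ ?_⟩
  have hp : 0 ≤ radialPotential M (r u v) := (radialPotential_pos hM (hr.1 u v)).le
  rw [abs_mul, abs_of_nonneg hp, mul_comm]
  refine mul_le_mul (hC u hu v) ?_ hp hC0
  exact (radialPotential_le hM.le (hr.pos hM.le u v)).trans (two_mul_div_cube_le_of_le hr hM hu v)

/-- `V · f` is integrable towards `𝓘⁺` on `{u ≤ U₀}`. [folklore] -/
lemma integrableOn_potential_mul {f : ℝ → ℝ → ℝ} (hf : UFam M r v₁ H ψ f) {u : ℝ} (hu : u ≤ U₀) (a : ℝ) :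
    IntegrableOn (fun v ↦ radialPotential M (r u v) * f u v) (Ioi a) := by
  obtain ⟨K, hK0, hK⟩ := exists_dominated hr hM hb hsupp hψ hf
  have hc : Continuous fun v ↦ radialPotential M (r u v) * f u v :=
    (ScatFam.continuous_uprimIntegrand hr hM hb (C 1) (hf.toScatFam hr hM)).comp
      (Continuous.prodMk_right u) |>.congr fun v ↦ by simp
  exact Integrable.mono' ((hr.integrableOn_two_mul_div_cube_Ioi hM U₀ a).const_mul K)
    hc.aestronglyMeasurable (Eventually.of_forall fun v ↦ by rw [Real.norm_eq_abs]; exact hK u hu v)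

/-- **Differentiation under `∫_{v₁}^{∞}` in `u`** for the integrands `V·f`, `f ∈ UFam`, on
`(−∞, U₀)`: `d/du ∫ V f = ∫ ∂ᵤ(V f)`. [folklore] -/
theorem hasDerivAt_integral_potential_mul {f : ℝ → ℝ → ℝ} (hf : UFam M r v₁ H ψ f) :
    ∃ f₁ : ℝ → ℝ → ℝ, UFam M r v₁ H ψ f₁ ∧ ∀ u, u < U₀ →
      HasDerivAt (fun u' ↦ ∫ v in Ioi v₁, radialPotential M (r u' v) * f u' v)
        (∫ v in Ioi v₁, radialPotential M (r u v) * f₁ u v) u := by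
  -- `∂ᵤ (V f) = V (εᵤ(1)(ρ) f + f')`
  obtain ⟨f', hf', hd⟩ := hf.exists_hasDerivAt_left hr hM hb
  set f₁ : ℝ → ℝ → ℝ := fun u v ↦ (C (-1) * potentialDerivPoly M 1).eval (r u v)⁻¹ * f u v + f' u v
    with hf₁
  have hf₁m : UFam M r v₁ H ψ f₁ := UFam.add (UFam.smul _ hf) hf'
  refine ⟨f₁, hf₁m, fun u hu ↦ ?_⟩
  obtain ⟨C₁, hC₁0, hC₁⟩ := exists_dominated hr hM hb hsupp hψ hf₁m
  have hgc : Continuous (uncurry fun u v ↦ radialPotential M (r u v) * f u v) := by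
    have := ScatFam.continuous_uprimIntegrand hr hM hb (C 1) (hf.toScatFam hr hM)
    exact this.congr fun p ↦ by simp
  have hg₁c : Continuous (uncurry fun u v ↦ radialPotential M (r u v) * f₁ u v) := by
    have := ScatFam.continuous_uprimIntegrand hr hM hb (C 1) (hf₁m.toScatFam hr hM)
    exact this.congr fun p ↦ by simp
  -- pointwise `u`-derivative of the integrand
  have hpt : ∀ u v, HasDerivAt (fun u' ↦ radialPotential M (r u' v) * f u' v)
      (radialPotential M (r u v) * f₁ u v) u := by
    intro u v
    have h1 : HasDerivAt (fun u' ↦ (potentialPoly M).eval (r u' v)⁻¹ * f u' v)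
        ((derivative (potentialPoly M) * invRadiusDerivPoly M).eval (r u v)⁻¹ * f u v +
          (potentialPoly M).eval (r u v)⁻¹ * f' u v) u :=
      (hasDerivAt_eval_invRadius_left hr hM _ u v).mul (hd u v)
    rw [show (fun u' ↦ radialPotential M (r u' v) * f u' v) =
        fun u' ↦ (potentialPoly M).eval (r u' v)⁻¹ * f u' v from
      funext fun u' ↦ by rw [radialPotential_eq_eval hr hM]]
    refine h1.congr_deriv ?_
    have hid := congrArg (fun Q : ℝ[X] ↦ Q.eval (r u v)⁻¹) (potentialPoly_identity M 1)
    simp only [eval_mul, eval_neg, neg_mul, mul_one] at hid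
    simp only [hf₁, eval_mul, eval_C, radialPotential_eq_eval hr hM]
    linear_combination (-(f u v)) * hid
  have key := hasDerivAt_integral_of_dominated_loc_of_deriv_le (μ := volume.restrict (Ioi v₁))
    (F := fun u' v ↦ radialPotential M (r u' v) * f u' v)
    (F' := fun u' v ↦ radialPotential M (r u' v) * f₁ u' v) (x₀ := u) (s := Iio U₀)
    (bound := fun v ↦ C₁ * (2 * M / r U₀ v ^ 3)) (Iio_mem_nhds hu)
    (Eventually.of_forall fun u' ↦
      ((hgc.comp (Continuous.prodMk_right u')).aestronglyMeasurable))
    (integrableOn_potential_mul hr hM hb hsupp hψ hf hu.le v₁)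
    ((hg₁c.comp (Continuous.prodMk_right u)).aestronglyMeasurable)
    (Eventually.of_forall fun v u' hu' ↦ by
      rw [Real.norm_eq_abs]; exact hC₁ u' (le_of_lt hu') v)
    ((hr.integrableOn_two_mul_div_cube_Ioi hM U₀ v₁).const_mul C₁)
    (Eventually.of_forall fun v u' _ ↦ hpt u' v)
  exact key.2

/-- **Smoothness of `u ↦ ∫_{v₁}^{∞} V f` on `(−∞, U₀)`** for `f ∈ UFam` (induction on the order).
[folklore] -/
theorem contDiffOn_integral_potential_mul : ∀ (n : ℕ) {f : ℝ → ℝ → ℝ}, UFam M r v₁ H ψ f →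
    ContDiffOn ℝ n (fun u ↦ ∫ v in Ioi v₁, radialPotential M (r u v) * f u v) (Iio U₀) := by
  intro n
  induction n with
  | zero =>
    intro f hf
    obtain ⟨f₁, -, hd⟩ := hasDerivAt_integral_potential_mul hr hM hb hsupp hψ hf
    exact contDiffOn_zero.2 fun u hu ↦ (hd u hu).continuousAt.continuousWithinAt
  | succ n ih =>
    intro f hf
    obtain ⟨f₁, hf₁, hd⟩ := hasDerivAt_integral_potential_mul hr hM hb hsupp hψ hf
    rw [show ((n + 1 : ℕ) : WithTop ℕ∞) = (n : WithTop ℕ∞) + 1 by push_cast; rfl,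
      contDiffOn_succ_iff_deriv_of_isOpen isOpen_Iio]
    refine ⟨fun u hu ↦ (hd u hu).differentiableAt.differentiableWithinAt,
      fun h ↦ absurd h (by exact_mod_cast WithTop.coe_ne_top), ?_⟩
    exact (ih hf₁).congr fun u hu ↦ (hd u hu).deriv

/-- **The limit of the radiation field on `𝓘⁺`**: `ψ(u, ∞) := −∫_{v₁}^{∞} ∫_{−∞}^{u} Vψ dv'`
("`rφ(u, ∞)`", Kehrberger). [cite: Kehrberger2022AHP, proof of Thm. 4.3] -/
def scatFutureLimit (M : ℝ) (r : ℝ → ℝ → ℝ) (v₁ : ℝ) (ψ : ℝ → ℝ → ℝ) (u : ℝ) : ℝ :=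
  -∫ v in Ioi v₁, uPrimitive (fun u v ↦ radialPotential M (r u v) * ψ u v) u v

omit hsupp in
/-- The inner integral `∫_{−∞}^{u} Vψ` is integrable towards `𝓘⁺` for `u ≤ U₀`
(`|·| ≤ Cψ M/r²`). [folklore] -/
lemma integrableOn_uPrimitive {u : ℝ} (hu : u ≤ U₀) :
    IntegrableOn (fun v ↦ uPrimitive (fun u v ↦ radialPotential M (r u v) * ψ u v) u v) (Ioi v₁) := by
  set g : ℝ → ℝ → ℝ := fun u v ↦ radialPotential M (r u v) * ψ u v with hg
  have hCψ : 0 ≤ Cψ := (abs_nonneg _).trans (hψ U₀ le_rfl 0)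
  have hgc : Continuous (uncurry g) := by
    have := ScatFam.continuous_uprimIntegrand hr hM hb (C 1) ScatFam.sol
    exact this.congr fun p ↦ by simp [hg]
  have hgd : IsPotentialDominated M r g := by
    have := ScatFam.isPotentialDominated_uprimIntegrand hr hM hb (C 1) ScatFam.sol
    refine fun V ↦ ?_
    obtain ⟨B, hB⟩ := this V
    exact ⟨B, fun u v hv ↦ by simpa [hg] using hB u v hv⟩
  have hc : Continuous fun v ↦ uPrimitive g u v :=
    (continuous_uPrimitive hr hM hgd hgc).comp (Continuous.prodMk_right u)
  refine Integrable.mono' ((hr.integrableOn_div_sq_Ioi hM u v₁).const_mul Cψ) hc.aestronglyMeasurable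
    (Eventually.of_forall fun v ↦ ?_)
  rw [Real.norm_eq_abs]
  refine abs_uPrimitive_le_of_le hr hM fun u' hu' ↦ ?_
  have hp : 0 ≤ radialPotential M (r u' v) := (radialPotential_pos hM (hr.1 u' v)).le
  simp only [hg]
  rw [abs_mul, abs_of_nonneg hp, mul_comm]
  exact mul_le_mul_of_nonneg_right (hψ u' (hu'.trans hu) v) hp

/-- **`ψ(u, ·) → ψ(u, ∞)` as `v → ∞`**, for `u ≤ U₀`. [cite: Kehrberger2022AHP, proof of Thm. 4.3] -/
theorem tendsto_scatFutureLimit (heq : ∀ u v, ψ u v = H v -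
      vPrimitive v₁ (uPrimitive fun u v ↦ radialPotential M (r u v) * ψ u v) u v)
    {u : ℝ} (hu : u ≤ U₀) :
    Tendsto (fun v ↦ ψ u v) atTop (𝓝 (scatFutureLimit M r v₁ ψ u)) := by
  have h1 : Tendsto (fun v ↦ H v) atTop (𝓝 0) := by
    refine tendsto_const_nhds.congr' ?_
    filter_upwards [eventually_ge_atTop v₂] with v hv
    exact (eq_zero_of_tsupport_subset_Ioo hsupp (Or.inr hv)).symm
  have h2 := intervalIntegral_tendsto_integral_Ioi v₁ (integrableOn_uPrimitive hr hM hb hψ hu) tendsto_id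
  have h := h1.sub h2
  rw [zero_sub] at h
  refine h.congr fun v ↦ ?_
  rw [heq u v, vPrimitive_apply]
  rfl

/-- **`u ↦ ψ(u, ∞)` is smooth on `(−∞, U₀)`**: its derivative is `−∫_{v₁}^{∞} Vψ`
(differentiation under the integral, `∂ᵤ ∫_{−∞}^{u} Vψ = Vψ`), which is smooth by
`contDiffOn_integral_potential_mul`. [folklore] -/
theorem contDiffOn_scatFutureLimit :
    ContDiffOn ℝ ((⊤ : ℕ∞) : WithTop ℕ∞) (scatFutureLimit M r v₁ ψ) (Iio U₀) := by
  set g : ℝ → ℝ → ℝ := fun u v ↦ radialPotential M (r u v) * ψ u v with hg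
  have hCψ : 0 ≤ Cψ := (abs_nonneg _).trans (hψ U₀ le_rfl 0)
  have hgc : Continuous (uncurry g) := by
    have := ScatFam.continuous_uprimIntegrand hr hM hb (C 1) ScatFam.sol
    exact this.congr fun p ↦ by simp [hg]
  have hgd : IsPotentialDominated M r g := by
    have := ScatFam.isPotentialDominated_uprimIntegrand hr hM hb (C 1) ScatFam.sol
    refine fun V ↦ ?_
    obtain ⟨B, hB⟩ := this V
    exact ⟨B, fun u v hv ↦ by simpa [hg] using hB u v hv⟩
  have hΞc : Continuous (uncurry (uPrimitive g)) := continuous_uPrimitive hr hM hgd hgc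
  -- the derivative of `u ↦ ∫ Ξ(u, ·)` on `(−∞, U₀)`
  have hd : ∀ u, u < U₀ → HasDerivAt (fun u' ↦ ∫ v in Ioi v₁, uPrimitive g u' v)
      (∫ v in Ioi v₁, g u v) u := by
    intro u hu
    have key := hasDerivAt_integral_of_dominated_loc_of_deriv_le (μ := volume.restrict (Ioi v₁))
      (F := fun u' v ↦ uPrimitive g u' v) (F' := fun u' v ↦ g u' v) (x₀ := u) (s := Iio U₀)
      (bound := fun v ↦ Cψ * (2 * M / r U₀ v ^ 3)) (Iio_mem_nhds hu)
      (Eventually.of_forall fun u' ↦ (hΞc.comp (Continuous.prodMk_right u')).aestronglyMeasurable)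
      (integrableOn_uPrimitive hr hM hb hψ hu.le)
      ((hgc.comp (Continuous.prodMk_right u)).aestronglyMeasurable)
      (Eventually.of_forall fun v u' hu' ↦ by
        have hp : 0 ≤ radialPotential M (r u' v) := (radialPotential_pos hM (hr.1 u' v)).le
        rw [Real.norm_eq_abs]
        show |radialPotential M (r u' v) * ψ u' v| ≤ _
        rw [abs_mul, abs_of_nonneg hp, mul_comm]
        refine mul_le_mul (hψ u' (le_of_lt hu') v) ?_ hp hCψ
        exact (radialPotential_le hM.le (hr.pos hM.le u' v)).trans
          (two_mul_div_cube_le_of_le hr hM (le_of_lt hu') v))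
      ((hr.integrableOn_two_mul_div_cube_Ioi hM U₀ v₁).const_mul Cψ)
      (Eventually.of_forall fun v u' _ ↦ hasDerivAt_uPrimitive_left hr hM hgd hgc u' v)
    exact key.2
  have hsmooth : ∀ n : ℕ, ContDiffOn ℝ n (fun u ↦ ∫ v in Ioi v₁, g u v) (Iio U₀) := fun n ↦ by
    have := contDiffOn_integral_potential_mul hr hM hb hsupp hψ n UFam.sol
    exact this
  refine contDiffOn_infty.2 fun n ↦ ?_
  cases n with
  | zero =>
    exact contDiffOn_zero.2 fun u hu ↦ ((hd u hu).neg).continuousAt.continuousWithinAt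
  | succ n =>
    rw [show ((n + 1 : ℕ) : WithTop ℕ∞) = (n : WithTop ℕ∞) + 1 by push_cast; rfl,
      contDiffOn_succ_iff_deriv_of_isOpen isOpen_Iio]
    refine ⟨fun u hu ↦ ((hd u hu).neg).differentiableAt.differentiableWithinAt,
      fun h ↦ absurd h (by exact_mod_cast WithTop.coe_ne_top), ?_⟩
    refine ((hsmooth n).neg).congr fun u hu ↦ ?_
    exact ((hd u hu).neg).deriv

end FutureLimit

/-! ### Discharge of the named fact -/

/-- **Discharge of `SchwarzschildLinearScattering_futureLimit`**: for a scattering solution `ψ`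
(the constructed field, by uniqueness), there is `U₀ < −1` such that `ψ(u, v) → ψ(u, ∞)` as
`v → ∞` for every `u < U₀`, with `u ↦ ψ(u, ∞)` smooth on `(−∞, U₀)` ("`rφ` attain[s] a limit on
`𝓘⁺`", "smooth functions", Kehrberger, proofs of Thms. 4.3 and 6.2).
[cite: Kehrberger2022AHP, proof of Thm. 4.3 and proof of Thm. 6.2] -/
theorem SchwarzschildLinearScattering_futureLimit_holds : SchwarzschildLinearScattering_futureLimit := by
  intro M hM r hr G v₁ v₂ _ hG hsupp ψ hψ
  obtain ⟨CG, hGb⟩ := exists_bound_of_tsupport hG.continuous hsupp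
  have hG0 : ∀ v, v ≤ v₁ → G v = 0 := fun v hv ↦ eq_zero_of_tsupport_subset_Ioo hsupp (Or.inl hv)
  -- `ψ` is the constructed field
  have hsol := isScatteringSolution_scatteringField hr hM hG hsupp hGb
  have e := SchwarzschildLinearScattering_unique_holds M hM r hr G v₁ _ _ hψ hsol
  subst e
  have hb := scatBootstrap_scatteringField hr hM hG hsupp hGb
  obtain ⟨U₀, hU₀, h4⟩ := exists_radius_ge hr hM v₁
  have hbound : ∀ u, u ≤ U₀ → ∀ v,
      |scatteringField hr hM hG.continuous hGb (data_eq_zero hsupp) u v| ≤ 2 * CG :=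
    fun u hu v ↦ abs_scatteringField_le_near_scri hr hM hG.continuous hGb (data_eq_zero hsupp) h4 hu v
  refine ⟨U₀, hU₀, scatFutureLimit M r v₁ (scatteringField hr hM hG.continuous hGb (data_eq_zero hsupp)),
    contDiffOn_scatFutureLimit hr hM hb hsupp hbound, fun u hu ↦ ?_⟩
  exact tendsto_scatFutureLimit hr hM hb hsupp hbound
    (scatteringField_eq hr hM hG.continuous hGb (data_eq_zero hsupp)) hu.le

end Literature.Barriers.FinalStateConjecture

end
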